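import Mathlib
import Literature.NumberTheory.Waring.PolygonalNumberTheorem
import Summits.ValiantsHypothesis.ValiantsHypothesis.Theorems.GrenetZeonTwoDimCoefficientsDualUnipotentWildCoreDim

/-!
# Crux `GrenetZeon.TwoDimCoefficients` (stmt-ValiantsHypothesis-8062), stub `stub_dualUnipotent`:
# the wild core, part 3 — the CONDITIONAL RUNG past Gerstenhaber's `√2·n` in closed form

Parts 1–2 (✓ `…DualUnipotentWildCore`, ✓ `…DualUnipotentWildCoreDim`) locate the open point of the stub
`DualUnipotentBound` (`DualUnipotentRepr n m → n² ≤ C·m`) in ONE object: in the Jordan–Hölder block form of the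
nilpotent space of a width-`m` unipotent-dual representation of `per_n` (`m ≤ 2n`, `n ≥ 64`) there is an
IRREDUCIBLE nilpotent diagonal block with `s₀ > n/4` members (✓ `exists_block_gt_quarter_of_dualUnipotentRepr`),
and that block satisfies `n² + C(s₀,2) ≤ 2n + #{(i,j) : lvl j < lvl i} + Σ_t C(b_t,2) + β` for every bound `β` on
the dimension of irreducible nilpotent subspaces of `M_{s₀}(ℂ)` (✓ `sq_add_choose_le_of_irreducible_bound`).

This file closes the bookkeeping announced there ("`#{(i,j) : lvl j < lvl i} + Σ_t C(b_t,2) = C(m,2)`", stated in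
the docstrings of part 2 but not typed) and assembles the pieces into ONE quantitative statement in the currency of
the stub, with the dimension bound as an EXPLICIT HYPOTHESIS SHAPE (constants `a, c, e, s₁`; nothing is assumed):

* `sum_card_level_eq`, `card_sameLevel_eq_sum_sq`,
  `two_mul_offDiag_add_two_mul_sum_choose_add` — pair counting: `2·#off + 2·Σ_t C(b_t,2) + m = m²`
  (the identity `2·C(b,2) + b = b²` is the tree's ✓ `Literature…PolygonalNumberTheorem.two_mul_choose_two_add`).
* ★ `sq_bound_of_irreducible_dim_bound` — if every irreducible nilpotent subspace `V ⊆ M_s(ℂ)` (`s ≥ s₁`) has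
  `c·dim V ≤ a·s² + e·s` with `2a ≤ c`, then for `n ≥ 64`, `4s₁ ≤ n` and every `m`:
  `DualUnipotentRepr n m → (32c + (c − 2a))·n² ≤ 16c·m² + (96c + 64e)·n`,
  i.e. `m² ≥ (2 + (1 − 2a/c)/16)·n² − O(n)`.  With `a/c = 1/2` (Gerstenhaber, known) this is the tree's `√2·n` rung
  again; ANY ratio `a/c < 1/2` valid for IRREDUCIBLE nilpotent spaces moves the constant past `√2`.
* `exists_rung_of_irreducible_dim_bound` — asymptotic form: `2a < c` ⟹ `∃ n₀, ∀ n ≥ n₀, ∀ m,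
  DualUnipotentRepr n m → (64c + 1)·n² ≤ 32c·m²` (`m ≥ √(2 + 1/(32c))·n`).
* `irreducible_dim_bound_half`, `sq_bound_at_half` (§3, appended) — non-vacuity: the hypothesis shape HOLDS at
  ratio `1/2` (Gerstenhaber, all nilpotent spaces), and the conditional rung then returns the unconditional
  `2n² ≤ m² + 6n`.

STATUS OF THE HYPOTHESIS (honest): whether irreducible nilpotent subspaces of `M_s(ℂ)` have dimension
`≤ (1/2 − ε)·s²` for some fixed `ε > 0` and all large `s` is the question raised by Mathes–Omladič–Radjavi
(Linear Algebra Appl. 149 (1991) 215–225, §5) and is OPEN; their irreducible examples have dimension a constant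
fraction `< 1/2` of `s²`, and the only bounds on record below `C(s,2)` are linear in `s` (near-maximal spaces are
triangularisable).  It enters here ONLY as the binder `hIRR`; no Literature fact is claimed.  The theorems are
therefore CONDITIONAL RUNGS: they make "R1 of the g4 census plugs into part 2" a single kernel statement, so that a
future proof (or refutation) of the dimension bound is priced in the stub's currency at once.

HONEST FRAMING: bookkeeping + a conditional rung for the located open point of an ASIDE item (8062 is `aside` in
route GrenetZeon since 2026-08-27); no stub, crux, rung or `VP ≠ VNP` is proved.  No definitions, no named facts.

References: M. Gerstenhaber, Amer. J. Math. 80 (1958), Thm. 1; B. Mathes, M. Omladič, H. Radjavi, Linear Algebra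
Appl. 149 (1991) 215–225, §5.
-/

-- single-conjunct layout `Summits/ValiantsHypothesis/ValiantsHypothesis`: the duplicated namespace
-- component is mandated by the tree.
set_option linter.dupNamespace false
set_option autoImplicit false

noncomputable section

namespace Summit.ValiantsHypothesis.ValiantsHypothesis.Cruxes.TwoDimCoefficients.DimTwoCases

open Matrix
open scoped BigOperators
open Literature.NumberTheory.Waring.PolygonalNumberTheorem (two_mul_choose_two_add)

variable {n m : ℕ}

/-! ### §1 Pair counting: `#off + Σ_t C(b_t,2) = C(m,2)` in subtraction-free form -/

/-- The level sizes add up to `m` (every index has a level `< L`). [folklore] -/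
theorem sum_card_level_eq (lvl : Fin m → ℕ) (L : ℕ) (hlvl : ∀ i, lvl i < L) :
    ∑ t ∈ Finset.range L, (Finset.univ.filter fun i => lvl i = t).card = m := by
  classical
  have h := Finset.card_eq_sum_card_fiberwise (s := (Finset.univ : Finset (Fin m))) (t := Finset.range L)
    (f := lvl) (fun i _ => Finset.mem_range.2 (hlvl i))
  rw [Finset.card_univ, Fintype.card_fin] at h
  exact h.symm

/-- The number of same-level pairs is `Σ_t b_t²`. [folklore] -/
theorem card_sameLevel_eq_sum_sq (lvl : Fin m → ℕ) (L : ℕ) (hlvl : ∀ i, lvl i < L) :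
    Fintype.card {q : Fin m × Fin m // lvl q.1 = lvl q.2} =
      ∑ t ∈ Finset.range L, (Finset.univ.filter fun i => lvl i = t).card ^ 2 := by
  classical
  rw [Fintype.card_subtype,
    Finset.card_eq_sum_card_fiberwise (s := Finset.univ.filter fun q : Fin m × Fin m => lvl q.1 = lvl q.2)
      (t := Finset.range L) (f := fun q => lvl q.1) (fun q _ => Finset.mem_range.2 (hlvl q.1))]
  refine Finset.sum_congr rfl fun t _ => ?_
  rw [Finset.filter_filter, sq, ← Finset.card_product, ← Finset.filter_product, Finset.univ_product_univ]
  congr 1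
  ext q
  simp only [Finset.mem_filter, Finset.mem_univ, true_and]
  constructor
  · rintro ⟨h1, h2⟩
    exact ⟨h2, h1 ▸ h2⟩
  · rintro ⟨h1, h2⟩
    exact ⟨h1.trans h2.symm, h1⟩

/-- **Pair count, binomial form.**  `2·#{(i,j) : lvl j < lvl i} + 2·Σ_{t<L} C(b_t,2) + m = m²`, i.e.
`#off + Σ_t C(b_t,2) = C(m,2)` (✓ `two_mul_card_offDiag_add_card_same` + `Σ_t b_t² = 2Σ_t C(b_t,2) + m`).
[folklore] -/
theorem two_mul_offDiag_add_two_mul_sum_choose_add (lvl : Fin m → ℕ) (L : ℕ) (hlvl : ∀ i, lvl i < L) :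
    2 * Fintype.card {q : Fin m × Fin m // lvl q.2 < lvl q.1} +
      2 * ∑ t ∈ Finset.range L, ((Finset.univ.filter fun i => lvl i = t).card).choose 2 + m = m ^ 2 := by
  have h1 := two_mul_card_offDiag_add_card_same lvl
  have h2 := card_sameLevel_eq_sum_sq lvl L hlvl
  have h3 : ∑ t ∈ Finset.range L, (Finset.univ.filter fun i => lvl i = t).card ^ 2 =
      2 * ∑ t ∈ Finset.range L, ((Finset.univ.filter fun i => lvl i = t).card).choose 2 +
        ∑ t ∈ Finset.range L, (Finset.univ.filter fun i => lvl i = t).card := by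
    rw [Finset.mul_sum, ← Finset.sum_add_distrib]
    exact Finset.sum_congr rfl fun t _ => (two_mul_choose_two_add _).symm
  rw [sum_card_level_eq lvl L hlvl] at h3
  omega

/-! ### §2 The conditional rung -/

/-- ★ **Conditional rung past `√2·n`, explicit form.**  Suppose every IRREDUCIBLE nilpotent linear subspace
`V ⊆ M_s(ℂ)` with `s ≥ s₁` satisfies `c·dim V ≤ a·s² + e·s`, where `2a ≤ c` (a HYPOTHESIS SHAPE — for `a/c < 1/2`
this is the open Mathes–Omladič–Radjavi question; for `a/c = 1/2` it is Gerstenhaber's theorem).  Then every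
unipotent-dual representation of `per_n` of width `m` (`n ≥ 64`, `4s₁ ≤ n`) satisfies
`(32c + (c − 2a))·n² ≤ 16c·m² + (96c + 64e)·n`, i.e. `m² ≥ (2 + (1 − 2a/c)/16)·n² − O(n)`.
Proof: for `m > 2n` the inequality is trivial; for `m ≤ 2n` take the irreducible Jordan–Hölder block with
`s₀ > n/4` members (✓ `exists_block_gt_quarter_of_dualUnipotentRepr`), feed `β = ⌊(a·s₀² + e·s₀)/c⌋` to
✓ `sq_add_choose_le_of_irreducible_bound`, and count pairs (`two_mul_offDiag_add_two_mul_sum_choose_add`).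
[folklore + Gerstenhaber 1958 via the tree; the dimension hypothesis is NOT a fact of the literature] -/
theorem sq_bound_of_irreducible_dim_bound (a c e s₁ : ℕ) (h2a : 2 * a ≤ c)
    (hIRR : ∀ s : ℕ, s₁ ≤ s → ∀ V : Submodule ℂ (Matrix (Fin s) (Fin s) ℂ), (∀ B ∈ V, IsNilpotent B) →
      (∀ U : Submodule ℂ (Fin s → ℂ), (∀ B ∈ V, ∀ x ∈ U, B *ᵥ x ∈ U) → U = ⊥ ∨ U = ⊤) →
      c * Module.finrank ℂ V ≤ a * s ^ 2 + e * s)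
    (hn : 64 ≤ n) (hs₁ : 4 * s₁ ≤ n) (h : DualUnipotentRepr n m) :
    (32 * c + (c - 2 * a)) * n ^ 2 ≤ 16 * c * m ^ 2 + (96 * c + 64 * e) * n := by
  classical
  obtain ⟨d, rfl⟩ : ∃ d, c = 2 * a + d := ⟨c - 2 * a, by omega⟩
  rw [show 2 * a + d - 2 * a = d by omega]
  by_cases hm : m ≤ 2 * n
  swap
  · -- `m > 2n`: `16c·m² ≥ 64c·n² ≥ (33c)·n²`
    have hm' : 2 * n + 1 ≤ m := by omega
    have h4 : 4 * n ^ 2 ≤ m ^ 2 := by nlinarith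
    have h5 : 16 * (2 * a + d) * (4 * n ^ 2) ≤ 16 * (2 * a + d) * m ^ 2 := Nat.mul_le_mul_left _ h4
    nlinarith [h5, Nat.zero_le ((96 * (2 * a + d) + 64 * e) * n), Nat.zero_le (a * n ^ 2),
      Nat.zero_le (d * n ^ 2)]
  by_cases hc0 : 2 * a + d = 0
  · -- degenerate constants: the left-hand side vanishes
    have ha : a = 0 := by omega
    have hd0 : d = 0 := by omega
    subst ha hd0
    simp
  have hc : 0 < 2 * a + d := Nat.pos_of_ne_zero hc0
  obtain ⟨N, M, hN, hM, hnil, hper, T, hT, P, L, lvl, hlvl, hPW, hirr, t, ht, hbig⟩ :=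
    exists_block_gt_quarter_of_dualUnipotentRepr hn h hm
  set s₀ := (Finset.univ.filter fun i => lvl i = t).card with hs₀
  let e₀ : {i : Fin m // lvl i = t} ≃ Fin s₀ := Fintype.equivFinOfCardEq (card_level_subtype lvl t)
  set β := (a * s₀ ^ 2 + e * s₀) / (2 * a + d) with hβ
  have h4s : n < 4 * s₀ := by
    have : n / 4 < s₀ := hbig
    omega
  have hs₁s₀ : s₁ ≤ s₀ := by omega
  have hβV : ∀ V : Submodule ℂ (Matrix (Fin s₀) (Fin s₀) ℂ), (∀ B ∈ V, IsNilpotent B) →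
      (∀ U : Submodule ℂ (Fin s₀ → ℂ), (∀ B ∈ V, ∀ x ∈ U, B *ᵥ x ∈ U) → U = ⊥ ∨ U = ⊤) →
      Module.finrank ℂ V ≤ β := by
    intro V hV hU
    rw [hβ, Nat.le_div_iff_mul_le hc, mul_comm]
    exact hIRR s₀ hs₁s₀ V hV hU
  have hmain := sq_add_choose_le_of_irreducible_bound N M hN hM hnil hper T hT P lvl L hlvl hPW ⟨t, ht⟩ e₀ β
    hβV (hirr t ht s₀ e₀)
  -- arithmetic
  have hpair := two_mul_offDiag_add_two_mul_sum_choose_add lvl L hlvl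
  have hch := two_mul_choose_two_add s₀
  have hβc : (2 * a + d) * β ≤ a * s₀ ^ 2 + e * s₀ := Nat.mul_div_le _ _
  have hsq : n ^ 2 ≤ 16 * s₀ ^ 2 := by nlinarith
  have hs₀m : s₀ ≤ m := by
    have := Finset.card_filter_le (Finset.univ : Finset (Fin m)) (fun i => lvl i = t)
    rwa [Finset.card_univ, Fintype.card_fin] at this
  have p2 : d * n ^ 2 ≤ d * (16 * s₀ ^ 2) := Nat.mul_le_mul_left _ hsq
  have p3 : (2 * e + (2 * a + d)) * s₀ ≤ (2 * e + (2 * a + d)) * (2 * n) :=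
    Nat.mul_le_mul_left _ (hs₀m.trans hm)
  have p4 : 0 ≤ (2 * a + d) * m := Nat.zero_le _
  have m1 := Nat.mul_le_mul_left (2 * (2 * a + d)) hmain
  have mpair : (2 * a + d) * (2 * Fintype.card {q : Fin m × Fin m // lvl q.2 < lvl q.1} +
      2 * ∑ t ∈ Finset.range L, ((Finset.univ.filter fun i => lvl i = t).card).choose 2 + m) =
      (2 * a + d) * m ^ 2 := by rw [hpair]
  have mch : (2 * a + d) * (2 * s₀.choose 2 + s₀) = (2 * a + d) * s₀ ^ 2 := by rw [hch]
  nlinarith [m1, mpair, mch, hβc, p2, p3, p4]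

/-- **Conditional rung, asymptotic form.**  If irreducible nilpotent subspaces of `M_s(ℂ)` (`s ≥ s₁`) have
`c·dim ≤ a·s² + e·s` with `2a < c` (ratio below Gerstenhaber's `1/2` — OPEN, hypothesis shape only), then
`∃ n₀, ∀ n ≥ n₀, ∀ m, DualUnipotentRepr n m → (64c + 1)·n² ≤ 32c·m²`: the width of every unipotent-dual
representation of `per_n` is at least `√(2 + 1/(32c))·n`, strictly past the unconditional `√2·n`
(✓ `two_mul_sq_le_of_dualUnipotentRepr`).  (Apply the explicit form to the doubled constants `2a, 2c, 2e`, whose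
gap `2c − 4a ≥ 2` absorbs the linear term.) [folklore; the dimension hypothesis is NOT a fact of the literature] -/
theorem exists_rung_of_irreducible_dim_bound (a c e s₁ : ℕ) (h2a : 2 * a < c)
    (hIRR : ∀ s : ℕ, s₁ ≤ s → ∀ V : Submodule ℂ (Matrix (Fin s) (Fin s) ℂ), (∀ B ∈ V, IsNilpotent B) →
      (∀ U : Submodule ℂ (Fin s → ℂ), (∀ B ∈ V, ∀ x ∈ U, B *ᵥ x ∈ U) → U = ⊥ ∨ U = ⊤) →
      c * Module.finrank ℂ V ≤ a * s ^ 2 + e * s) :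
    ∃ n₀ : ℕ, ∀ n ≥ n₀, ∀ m : ℕ, DualUnipotentRepr n m → (64 * c + 1) * n ^ 2 ≤ 32 * c * m ^ 2 := by
  refine ⟨max 64 (max (4 * s₁) (192 * c + 128 * e)), fun n hn m h => ?_⟩
  have hn64 : 64 ≤ n := le_trans (le_max_left _ _) hn
  have hs₁ : 4 * s₁ ≤ n := le_trans (le_trans (le_max_left _ _) (le_max_right _ _)) hn
  have hK : 192 * c + 128 * e ≤ n := le_trans (le_trans (le_max_right _ _) (le_max_right _ _)) hn
  have hIRR2 : ∀ s : ℕ, s₁ ≤ s → ∀ V : Submodule ℂ (Matrix (Fin s) (Fin s) ℂ), (∀ B ∈ V, IsNilpotent B) →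
      (∀ U : Submodule ℂ (Fin s → ℂ), (∀ B ∈ V, ∀ x ∈ U, B *ᵥ x ∈ U) → U = ⊥ ∨ U = ⊤) →
      2 * c * Module.finrank ℂ V ≤ 2 * a * s ^ 2 + 2 * e * s := by
    intro s hs V hV hU
    have := hIRR s hs V hV hU
    nlinarith [this]
  have hmain := sq_bound_of_irreducible_dim_bound (n := n) (m := m) (2 * a) (2 * c) (2 * e) s₁ (by omega)
    hIRR2 hn64 hs₁ h
  obtain ⟨d, hd⟩ : ∃ d, 2 * c - 2 * (2 * a) = d + 2 := ⟨2 * c - 2 * (2 * a) - 2, by omega⟩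
  rw [hd] at hmain
  have q1 : (192 * c + 128 * e) * n ≤ n * n := Nat.mul_le_mul_right _ hK
  have q2 : 0 ≤ d * n ^ 2 := Nat.zero_le _
  nlinarith [hmain, q1, q2]

/-! ### §3 Non-vacuity: the hypothesis shape at Gerstenhaber's ratio `a/c = 1/2` is a THEOREM, and the
conditional rung then specialises to the unconditional `√2·n` rung -/

/-- **The hypothesis shape holds at ratio `1/2` (Gerstenhaber).**  Every nilpotent linear subspace of `M_s(ℂ)` —
irreducible or not — has `2·dim ≤ 1·s² + 0·s` (✓ `Literature…finrank_le_choose_two`).  So the binder `hIRR` of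
`sq_bound_of_irreducible_dim_bound` is satisfiable with `(a, c, e, s₁) = (1, 2, 0, 0)`; the open question is
only whether the ratio drops below `1/2` on IRREDUCIBLE spaces. [cite: Gerstenhaber1958, Thm. 1 — via the tree] -/
theorem irreducible_dim_bound_half (s : ℕ) (V : Submodule ℂ (Matrix (Fin s) (Fin s) ℂ))
    (hV : ∀ B ∈ V, IsNilpotent B) : 2 * Module.finrank ℂ V ≤ 1 * s ^ 2 + 0 * s := by
  have h := Literature.LinearAlgebra.Matrix.GerstenhaberNilpotentSubspace.finrank_le_choose_two s V hV
  have hch := two_mul_choose_two_add s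
  omega

/-- **Specialisation check (unconditional).**  Feeding Gerstenhaber's ratio `(a, c, e, s₁) = (1, 2, 0, 0)` to
`sq_bound_of_irreducible_dim_bound` returns `64·n² ≤ 32·m² + 192·n`, i.e. the tree's `√2·n` rung
`2n² ≤ m² + 6n` for `n ≥ 64` (✓ `two_mul_sq_le_of_dualUnipotentRepr` has `+ 4n`): the conditional rung is
not vacuous and is continuous in the ratio at `1/2`. [folklore] -/
theorem sq_bound_at_half (hn : 64 ≤ n) (h : DualUnipotentRepr n m) : 2 * n ^ 2 ≤ m ^ 2 + 6 * n := by
  have h1 := sq_bound_of_irreducible_dim_bound (n := n) (m := m) 1 2 0 0 (by norm_num)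
    (fun s _ V hV _ => irreducible_dim_bound_half s V hV) hn (Nat.zero_le _) h
  omega

end Summit.ValiantsHypothesis.ValiantsHypothesis.Cruxes.TwoDimCoefficients.DimTwoCases

end
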